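import Summits.QuantumFields.BalabanUV.Beta.CompositeVertexWardRootedPacked
import Summits.QuantumFields.BalabanUV.Beta.WardLocusSymSockets
import Summits.QuantumFields.BalabanUV.Beta.FP.TowerNColumnWardLaw

/-!
# `BalabanUV.Beta.CompositeStencilWardRootedDM` — row D1 ∕ (C1), PART 108: THE `hD` LETTER OF an2 g29's MEMBER-0 MACHINERY FOR THE ROOTED COMPOSITE TABLES —
# the unfolded first-order vertex `dM (AN R j) N (SpureRecOf … 0) M₀` has the pure-gauge divergence `conjV (bhKcomp …) (X y)` (generic glue over PART 105b + PART 102∕107)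

HONEST DEPENDENCY (page 1, mandatory): continuum YM on T⁴ ⇐ BetaPertH ∧ nine spine estimates (0/9 proved); BetaPertH ⇐ (D1) ∧ (D4) ∧ CAP+tail;
G-an2-4 gates asym, D1 and NE2/3/4.  HONEST FRAMING (cell contract, verbatim): «discharging `BetaPertH` makes Bałaban's UV stability UNCONDITIONAL —
a real constructive-QFT result; it is NOT the continuum limit and NOT the Clay problem.»  ABSOLUTE RULE (cell charter, verbatim): «No internally-minted
statement may enter as a cited fact. Every hypothesis is either kernel-proved in this package or a verbatim quotation of a PUBLISHED theorem with page
reference. The manuscript(s) under audit are NOT citable for their own disputed steps — they are the thing under adjudication; programme-internal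
(2001/route/tribunal) claims are never citable.»

WHY (row-D1 owner an2 gen 86, `gen86/HWD-SCOPING.md` §1 (first order) ∕ §1b).  `WardLocusRecursiveAllSlot.divW_WrecOf_zero_of_letters` wants `hD 0`:
`divV (dM (G 0) N (SpureRecOf d N V H G cE cVH cΛ 0) (M 0)) y = conjV (𝕄 0) (diagK (ξ • Σ_v legInd ρ (N•y+v)))`.  an1's `KernelWardMColumn.divV_dM_eq_conjV` reduces it to the chart's
(hMw)(hH) letters, the stencil's (S)-law and a bound on the multiplier table.  At the composite triple `G := AN R j`, `𝕄 := bhKcomp R.rc Lc (j+1)`, `N = Lc^(j+1)`, with the ROOTED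
composite V-table `compVhS (linKerAt ∘ R.rc) (vhKerAt ∘ R.rc) Lc (j+1)`, ANY every-rate-localised Hessian table `H`, ANY bounded multiplier table `M₀`: (hMw) = PART 107 `colM_ward_AN`,
(hH) = PART 102 `colH_ward_AN` (constant `((Lc^(j+1))⁴)⁻¹`), (S) = PART 105b `hSd_S0NOf_compVhS_rooted` (through `WardLocusSymSockets.divV_SpureRecOf_eq_divV_SrecOf`: the pure spine and the
full one have the same divergence), decay = an2 `decays_AN`.  Pins: `cH = ((Lc^(j+1))⁴)⁻¹` (PART 102), `cH·cE·½ = ξ`, `cH·cVH = −ξ·(Lc⁴)^(j+1)`.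

WHAT: [folklore] composition BY NAME; no `def`, no `def … : Prop`, nothing cited, 0 sorry.  Nothing of Bałaban's asserted, valued or discharged; 0 estimates; 0∕4 row-D1 binders;
(W)_j NOT claimed; NOT (C1), NOT D1, NEVER «G-an2-4 closed», NOT BetaPertH, NOT continuum, NOT Clay.  Row D1 ∕ (C1) OWNER «beta-an2», gen 86, 2026-08-30.  No existing file touched.
-/

noncomputable section

open Finset
open scoped BigOperators
open Literature.MathematicalPhysics.QuantumFieldTheory
open Literature.MathematicalPhysics.QuantumFieldTheory.Balaban1983to89
open Literature.MathematicalPhysics.QuantumFieldTheory.Balaban1983to89.Beta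
open ExpKernelCalculus (MKer VertexFamily)
open OneStepResolventKernel (Fib)
open KernelWard (divV)
open AffineAveraging (Site box toSite)
open AveragingHessianKernelsRooted (linKerAt vhKerAt)
open SecondOrderResponse (dM)
open Summit.QuantumFields.BalabanUV.Beta.ChartConjugation (conjV)
open Summit.QuantumFields.BalabanUV.Beta.BorderedHessian (diagK)
open Summit.QuantumFields.BalabanUV.Beta.AveragingWardRootedStencils (legInd)
open Summit.QuantumFields.BalabanUV.Beta.AxialDressingRooted (one_le_of_neZero)
open Summit.QuantumFields.BalabanUV.Beta.SpineRooted (SpureRecOf locStencil_SpureRecOf)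
open Summit.QuantumFields.BalabanUV.Beta.WardLocusRecursive (SrecOf_zero)
open Summit.QuantumFields.BalabanUV.Beta.RelInvComposite (bhKcomp)
open Summit.QuantumFields.BalabanUV.Beta.CompositeVertexKernelRec (compVhS)
open Summit.QuantumFields.BalabanUV.Beta.CompositeOneShotJetData (Roots AN)
open Summit.QuantumFields.BalabanUV.Beta.NVertexSectors (decays_AN)
open Summit.QuantumFields.BalabanUV.Beta.WardLocusSymSockets (divV_SpureRecOf_eq_divV_SrecOf)
open Summit.QuantumFields.BalabanUV.Beta.KernelWardMColumn (divV_dM_eq_conjV)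
open Summit.QuantumFields.BalabanUV.Beta.FP.TowerNColumnWardLaw (colH_ward_AN colM_ward_AN)
open Summit.QuantumFields.BalabanUV.Beta.CompositeVertexWardRootedPacked (hSd_S0NOf_compVhS_rooted)

namespace Summit.QuantumFields.BalabanUV.Beta.CompositeStencilWardRootedDM

variable {Lc : ℕ} [NeZero Lc] (R : Roots Lc)

/-- [folklore] **THE (S)-LAW OF THE PURE (Λ-free) SLOTTED SPINE OVER THE ROOTED COMPOSITE V-TABLE** (member `0`, lattice `Lc^(j+1)`, composed root of `R.rc`): PART 105b's
`hSd_S0NOf_compVhS_rooted` carried from `SrecOf … 0 = S0NOf` to `SpureRecOf … 0` (same divergence: `divV_SpureRecOf_eq_divV_SrecOf`). -/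
theorem hSd_SpureRecOf_compVhS_rooted (j : ℕ) (H : Fin (3 + 1) → (Fin (3 + 1) → ℤ) → MKer (3 + 1) (Fib 3))
    (hH : ∀ δ : ℝ, 0 ≤ δ → ∃ C : ℝ, VertexFamily H (Lc ^ (j + 1)) C δ) (G : ℕ → MKer (3 + 1) (Fib 3))
    {cE cVH cH ξ : ℝ} (cΛ : ℝ) (h₁ : cH * cE * (1 / 2) = ξ) (h₂ : cH * cVH = -(ξ * ((Lc : ℝ) ^ (3 + 1)) ^ (j + 1))) (y : Site (3 + 1)) :
    cH • ∑ v ∈ box (3 + 1) (Lc ^ (j + 1)), divV (SpureRecOf 3 (Lc ^ (j + 1))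
        (compVhS (fun k => linKerAt (toSite (R.rc k)) Lc) (fun k => vhKerAt (toSite (R.rc k)) Lc) Lc (j + 1)) H G cE cVH cΛ 0)
        ((((Lc ^ (j + 1) : ℕ) : ℤ)) • y + toSite v) =
      conjV (bhKcomp (d := 3) R.rc Lc (j + 1)) (diagK (ξ • ∑ v ∈ box (3 + 1) (Lc ^ (j + 1)),
        legInd (∑ k ∈ Finset.range (j + 1), ((Lc ^ k : ℕ) : ℤ) • toSite (R.rc k)) ((((Lc ^ (j + 1) : ℕ) : ℤ)) • y + toSite v))) := by
  have e : ∀ v ∈ box (3 + 1) (Lc ^ (j + 1)),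
      divV (SpureRecOf 3 (Lc ^ (j + 1)) (compVhS (fun k => linKerAt (toSite (R.rc k)) Lc) (fun k => vhKerAt (toSite (R.rc k)) Lc) Lc (j + 1)) H G cE cVH cΛ 0)
          ((((Lc ^ (j + 1) : ℕ) : ℤ)) • y + toSite v) =
        divV (SpineRooted.S0NOf 3 (Lc ^ (j + 1)) (compVhS (fun k => linKerAt (toSite (R.rc k)) Lc) (fun k => vhKerAt (toSite (R.rc k)) Lc) Lc (j + 1)) H cE cVH cΛ)
          ((((Lc ^ (j + 1) : ℕ) : ℤ)) • y + toSite v) := by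
    intro v _
    rw [divV_SpureRecOf_eq_divV_SrecOf hH cE cVH cΛ 0, SrecOf_zero]
  rw [Finset.sum_congr rfl e]
  exact hSd_S0NOf_compVhS_rooted (one_le_of_neZero Lc) R.hrc (j + 1) H hH cΛ h₁ h₂ y

/-- [folklore] **`hDᴿ` — THE FIRST-ORDER WARD LAW OF THE UNFOLDED VERTEX AT THE COMPOSITE TRIPLE, ROOTED TABLES** (the `hD 0` letter of an2 g29's
`WardLocusRecursiveAllSlot.divW_WrecOf_zero_of_letters` at `G := AN R j`, `𝕄 := bhKcomp R.rc Lc (j+1)`, `N := Lc^(j+1)`, rooted composite V-table, ANY every-rate-localised `H`, ANY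
bounded multiplier table `M₀`, pins `cH = ((Lc^(j+1))⁴)⁻¹`, `cH·cE·½ = ξ`, `cH·cVH = −ξ·(Lc⁴)^(j+1)`). -/
theorem divV_dM_AN_compVhS_rooted (j : ℕ) (H : Fin (3 + 1) → (Fin (3 + 1) → ℤ) → MKer (3 + 1) (Fib 3))
    (hH : ∀ δ : ℝ, 0 ≤ δ → ∃ C : ℝ, VertexFamily H (Lc ^ (j + 1)) C δ) (G : ℕ → MKer (3 + 1) (Fib 3))
    (hG : ∀ k : ℕ, ∃ δ C : ℝ, 0 < δ ∧ 0 ≤ C ∧ ExpKernelCalculus.Decays (G k) C δ)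
    {M₀ : Fin (3 + 1) → (Fin (3 + 1) → ℤ) → MKer (3 + 1) (Fib 3)} {B : ℝ} (hM₀ : ∀ ρ w x z a b, |M₀ ρ w x z a b| ≤ B)
    {cE cVH ξ : ℝ} (cΛ : ℝ) (h₁ : ((((Lc ^ (j + 1) : ℕ) : ℝ)) ^ (3 + 1))⁻¹ * cE * (1 / 2) = ξ)
    (h₂ : ((((Lc ^ (j + 1) : ℕ) : ℝ)) ^ (3 + 1))⁻¹ * cVH = -(ξ * ((Lc : ℝ) ^ (3 + 1)) ^ (j + 1))) (y : Site (3 + 1)) :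
    divV (dM (AN R j) (Lc ^ (j + 1)) (SpureRecOf 3 (Lc ^ (j + 1))
        (compVhS (fun k => linKerAt (toSite (R.rc k)) Lc) (fun k => vhKerAt (toSite (R.rc k)) Lc) Lc (j + 1)) H G cE cVH cΛ 0) M₀) y =
      conjV (bhKcomp (d := 3) R.rc Lc (j + 1)) (diagK (ξ • ∑ v ∈ box (3 + 1) (Lc ^ (j + 1)),
        legInd (∑ k ∈ Finset.range (j + 1), ((Lc ^ k : ℕ) : ℤ) • toSite (R.rc k)) ((((Lc ^ (j + 1) : ℕ) : ℤ)) • y + toSite v))) := by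
  have hLc : 1 ≤ Lc := one_le_of_neZero Lc
  have hV : ∀ δ : ℝ, 0 ≤ δ → ∃ C : ℝ, OneStepResolventKernel.LocStencil
      (compVhS (fun k => linKerAt (toSite (R.rc k)) Lc) (fun k => vhKerAt (toSite (R.rc k)) Lc) Lc (j + 1)) C δ :=
    fun δ hδ => ⟨_, CompositeVertexKernelRec.locStencil_compVhS_rooted hLc R.hrc (j + 1) hδ⟩
  obtain ⟨Cs, δs, hδs, hS⟩ := locStencil_SpureRecOf (d := 3) (Lc := Lc ^ (j + 1)) (one_le_of_neZero (Lc ^ (j + 1))) hV hH hG cE cVH cΛ 0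
  exact divV_dM_eq_conjV (N := Lc ^ (j + 1)) (decays_AN R j) (one_le_of_neZero (Lc ^ (j + 1))) (fun y ρ w => colM_ward_AN Lc R j y ρ w) hS hδs
    (((((Lc ^ (j + 1) : ℕ) : ℝ)) ^ (3 + 1))⁻¹) (fun y κ' u => colH_ward_AN Lc R j y κ' u)
    (fun y => hSd_SpureRecOf_compVhS_rooted R j H hH G cΛ h₁ h₂ y) hM₀ y

end Summit.QuantumFields.BalabanUV.Beta.CompositeStencilWardRootedDM

end
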